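import Mathlib.Analysis.SpecialFunctions.Exp
import Mathlib.Analysis.SpecialFunctions.Pow.Real
import HarnessLib

/-!
# Route `SwapVirialDeficit` (YangMills): THE PROFILE CURRENCY OF THE TIP CAPS — `q²·(joint factor)·(relative factor) ≤ K∕(b′²·s²(s² + q))`
# (cell ym-idea-1, skeleton ➎ v14, `stub_core_tip`, socket (hCore); LEAD ruling (B6) 2026-09-01 01:5xZ for w2 g61's per-cap assembly S3 on w3 g68's caps ✓`…TipCaps`;
# LEAD seat ym-line-sfw-p2 g100, free-hands support of ⟨stmt-QuantumFields-24197⟩ `SwapVirialDeficit.SwapGluedStiffness`)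

Mathlib-only, pure real inequalities.  Letters: `s² = (1+δt²)⁻¹` (hub `hubAt δt 1`), `q ≍ |p̃|²`-type adapted base size, `b′ = b∕(7200L⁶)`, Jacobian `q² = |p̃|⁴`
(✓`lintegral_eq_jointRel`); the frozen binder's Profile is `(1+δt²)²∕(1 + h(1+δt²)) = (s²(s²+h))⁻¹` (`profile_eq`).
* §1 `mul_exp_neg_le`, `sq_mul_exp_neg_le`, `cube_mul_exp_neg_le` — `X^k·e^{−θX} ≤ (k∕θ)^k` (`k = 1, 2, 3`, `θ > 0`).
* §2 ★ `capAxis_profile_le` — THE AXIS CAP `R₀` (joint axis within 60° of `e₀`): the relative `ρ⃗`-curvature keeps the individual-tilt term, `|p|²(4s² + C|p|²)`, and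
  Gaussian × Gaussian already matches: `q²·(π∕(θb′s²q))·(π∕(b′q(4s² + Cq))) ≤ (π²∕(θ·min(4,C)))∕(b′²s²(s²+q))` — no case analysis; `capAxis_profile_le_of_min` (with the disc mins).
* §3 ★ `capHill_profile_le` — THE HILLTOP CAPS `R₁, R₂` (joint axis ≥ 30° from `e₀`): the joint factor is the POINTWISE floor `A₁·e^{−θ·b′s²q}` (disc area `A₁`), the
  relative factor is `min(A₂, π∕(b′Cq²))` (cross term ONLY — the `e₀`-ward directions are downhill), and
  `q²·(A₁e^{−θb′s²q})·min(A₂, π∕(b′Cq²)) ≤ K_hill∕(b′²s²(s²+q))`, `K_hill = A₁A₂((2∕θ)² + (3∕θ)³) + (A₁π∕C)(1 + 1∕θ)`, by the regime split `b′s⁴ ≥ 1` (saturated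
  `ρ⃗`: `X²e^{−θX} + X³e^{−θX}∕(b′s⁴)`, `X = b′s²q`) ∕ `b′s⁴ < 1` (Gaussian `ρ⃗`: `e^{−θX}(b′s⁴ + X)`); either branch alone fails (by `q∕s²`, resp. `b′s⁴`).
* §4 `profile_eq` — `(s²(s² + h))⁻¹ = (1+δ²)²∕(1 + h(1+δ²))` for `s² = (1+δ²)⁻¹`; `inv_sq_mul_le_profile_of_le` (monotone in `q ≤ h`-type comparisons).

HONEST LABEL: elementary real analysis; `stub_core_tip`, ⟨24197⟩ ∕ ⟨24194⟩ OPEN; own crux ⟨22884⟩ `LargeFieldMassRefinementTail` OPEN (blocked-on ⟨19935⟩); the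
Yang–Mills mass gap is NOT proved; no summit is proved by a line.  THEOREMS ONLY (0 `def`, 0 `sorry`, no instance, no notation), standard axioms.
`--supports stmt-QuantumFields-24197`.  References: [folklore].
-/

set_option autoImplicit false

noncomputable section

open Real

namespace Summit.QuantumFields.YangMills.Theorems.QuantitativeLaplace

/-! ## §1 Polynomial × exponential -/

/-- `Y·e^{−Y} ≤ 1` for every real `Y` (private copy of a folklore one-liner that several tree files keep private, e.g.
✓`Literature.NumberTheory.Automorphic.SelbergDecay.mul_exp_neg_le_one`; not re-exported). [folklore] -/
private theorem mul_exp_neg_self_le_one' (Y : ℝ) : Y * Real.exp (-Y) ≤ 1 := by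
  have h1 : Y ≤ Real.exp Y := by linarith [Real.add_one_le_exp Y]
  calc Y * Real.exp (-Y) ≤ Real.exp Y * Real.exp (-Y) := by gcongr
    _ = 1 := by rw [← Real.exp_add, add_neg_cancel, Real.exp_zero]

/-- `0 ≤ Y·e^{−Y}` for `Y ≥ 0`. [folklore] -/
theorem mul_exp_neg_self_nonneg {Y : ℝ} (hY : 0 ≤ Y) : 0 ≤ Y * Real.exp (-Y) :=
  mul_nonneg hY (Real.exp_pos _).le

/-- §1 `X·e^{−θX} ≤ 1∕θ` (every real `X`, `θ > 0`). [folklore] -/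
theorem mul_exp_neg_le (X : ℝ) {θ : ℝ} (hθ : 0 < θ) : X * Real.exp (-(θ * X)) ≤ 1 / θ := by
  have h := mul_exp_neg_self_le_one' (θ * X)
  rw [le_div_iff₀ hθ]
  calc X * Real.exp (-(θ * X)) * θ = θ * X * Real.exp (-(θ * X)) := by ring
    _ ≤ 1 := h

/-- §1 `X²·e^{−θX} ≤ (2∕θ)²` (`X ≥ 0`, `θ > 0`). [folklore] -/
theorem sq_mul_exp_neg_le {X θ : ℝ} (hX : 0 ≤ X) (hθ : 0 < θ) : X ^ 2 * Real.exp (-(θ * X)) ≤ (2 / θ) ^ 2 := by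
  have hY : 0 ≤ θ * X / 2 := by positivity
  have h1 := mul_exp_neg_self_le_one' (θ * X / 2)
  have h0 := mul_exp_neg_self_nonneg hY
  have e : X ^ 2 * Real.exp (-(θ * X)) = (2 / θ) ^ 2 * (θ * X / 2 * Real.exp (-(θ * X / 2))) ^ 2 := by
    rw [mul_pow, ← Real.exp_nat_mul]
    push_cast
    rw [show (2 : ℝ) * -(θ * X / 2) = -(θ * X) by ring]
    field_simp
  rw [e]
  calc (2 / θ) ^ 2 * (θ * X / 2 * Real.exp (-(θ * X / 2))) ^ 2 ≤ (2 / θ) ^ 2 * 1 := by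
        gcongr; exact pow_le_one₀ h0 h1
    _ = (2 / θ) ^ 2 := mul_one _

/-- §1 `X³·e^{−θX} ≤ (3∕θ)³` (`X ≥ 0`, `θ > 0`). [folklore] -/
theorem cube_mul_exp_neg_le {X θ : ℝ} (hX : 0 ≤ X) (hθ : 0 < θ) : X ^ 3 * Real.exp (-(θ * X)) ≤ (3 / θ) ^ 3 := by
  have hY : 0 ≤ θ * X / 3 := by positivity
  have h1 := mul_exp_neg_self_le_one' (θ * X / 3)
  have h0 := mul_exp_neg_self_nonneg hY
  have e : X ^ 3 * Real.exp (-(θ * X)) = (3 / θ) ^ 3 * (θ * X / 3 * Real.exp (-(θ * X / 3))) ^ 3 := by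
    rw [mul_pow, ← Real.exp_nat_mul]
    push_cast
    rw [show (3 : ℝ) * -(θ * X / 3) = -(θ * X) by ring]
    field_simp
  rw [e]
  have h3 : 0 ≤ (3 / θ) ^ 3 := by positivity
  calc (3 / θ) ^ 3 * (θ * X / 3 * Real.exp (-(θ * X / 3))) ^ 3 ≤ (3 / θ) ^ 3 * 1 := by
        gcongr; exact pow_le_one₀ h0 h1
    _ = (3 / θ) ^ 3 := mul_one _

/-! ## §2 The axis cap `R₀`: Gaussian × Gaussian matches the Profile -/

/-- ★ §2 THE AXIS CAP: `q²·(π∕(θb′s²q))·(π∕(b′q(4s² + Cq))) ≤ (π²∕(θ·min(4,C)))∕(b′²·s²·(s²+q))` (`θ, C, b′, s, q > 0`). [folklore] -/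
theorem capAxis_profile_le {θ C b s q : ℝ} (hθ : 0 < θ) (hC : 0 < C) (hb : 0 < b) (hs : 0 < s) (hq : 0 < q) :
    q ^ 2 * (π / (θ * (b * s ^ 2 * q))) * (π / (b * q * (4 * s ^ 2 + C * q))) ≤
      (π ^ 2 / (θ * min 4 C)) / (b ^ 2 * s ^ 2 * (s ^ 2 + q)) := by
  have hm : 0 < min 4 C := lt_min (by norm_num) hC
  have hmin : min 4 C * (s ^ 2 + q) ≤ 4 * s ^ 2 + C * q := by
    have h4 : min 4 C ≤ 4 := min_le_left _ _
    have hC' : min 4 C ≤ C := min_le_right _ _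
    nlinarith [sq_nonneg s, hq.le]
  have e : q ^ 2 * (π / (θ * (b * s ^ 2 * q))) * (π / (b * q * (4 * s ^ 2 + C * q))) = π ^ 2 / (θ * (b ^ 2 * s ^ 2 * (4 * s ^ 2 + C * q))) := by
    field_simp
  rw [e, div_div, div_le_div_iff_of_pos_left (by positivity) (by positivity) (by positivity)]
  calc θ * min 4 C * (b ^ 2 * s ^ 2 * (s ^ 2 + q)) = θ * (b ^ 2 * s ^ 2 * (min 4 C * (s ^ 2 + q))) := by ring
    _ ≤ θ * (b ^ 2 * s ^ 2 * (4 * s ^ 2 + C * q)) := by gcongr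

/-- §2 with the disc saturations in place (they are simply dropped): for any `A₁` and an area `A₂ ≥ 0`,
`q²·min(A₁, π∕(θb′s²q))·min(A₂, π∕(b′q(4s²+Cq))) ≤ (π²∕(θ·min(4,C)))∕(b′²s²(s²+q))`. [folklore] -/
theorem capAxis_profile_le_of_min {A₁ A₂ θ C b s q : ℝ} (hA₂ : 0 ≤ A₂) (hθ : 0 < θ) (hC : 0 < C) (hb : 0 < b) (hs : 0 < s)
    (hq : 0 < q) :
    q ^ 2 * min A₁ (π / (θ * (b * s ^ 2 * q))) * min A₂ (π / (b * q * (4 * s ^ 2 + C * q))) ≤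
      (π ^ 2 / (θ * min 4 C)) / (b ^ 2 * s ^ 2 * (s ^ 2 + q)) := by
  have h2 : 0 ≤ min A₂ (π / (b * q * (4 * s ^ 2 + C * q))) := le_min hA₂ (by positivity)
  calc q ^ 2 * min A₁ (π / (θ * (b * s ^ 2 * q))) * min A₂ (π / (b * q * (4 * s ^ 2 + C * q)))
      ≤ q ^ 2 * (π / (θ * (b * s ^ 2 * q))) * (π / (b * q * (4 * s ^ 2 + C * q))) :=
        mul_le_mul (mul_le_mul_of_nonneg_left (min_le_right _ _) (sq_nonneg q)) (min_le_right _ _) h2 (by positivity)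
    _ ≤ _ := capAxis_profile_le hθ hC hb hs hq

/-! ## §3 The hilltop caps `R₁, R₂`: pointwise joint floor × saturated-or-Gaussian relative factor -/

/-- The saturated branch (`b′s⁴ ≥ 1`): `q²·e^{−θb′s²q}·b′²s²(s²+q) ≤ (2∕θ)² + (3∕θ)³`. [folklore] -/
theorem capHill_saturated_core {θ b s q : ℝ} (hθ : 0 < θ) (hb : 0 < b) (hs : 0 < s) (hq : 0 < q) (hreg : 1 ≤ b * s ^ 4) :
    q ^ 2 * Real.exp (-(θ * (b * s ^ 2 * q))) * (b ^ 2 * s ^ 2 * (s ^ 2 + q)) ≤ (2 / θ) ^ 2 + (3 / θ) ^ 3 := by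
  set X := b * s ^ 2 * q with hX
  have hX0 : 0 ≤ X := by positivity
  have hE0 : 0 ≤ Real.exp (-(θ * X)) := (Real.exp_pos _).le
  have h2 := sq_mul_exp_neg_le hX0 hθ
  have h3 := cube_mul_exp_neg_le hX0 hθ
  -- `q² b² s² (s² + q) = X² + X³/(b s⁴)` and `1/(b s⁴) ≤ 1`
  have hbs4 : 0 < b * s ^ 4 := by positivity
  have e : q ^ 2 * Real.exp (-(θ * X)) * (b ^ 2 * s ^ 2 * (s ^ 2 + q)) =
      X ^ 2 * Real.exp (-(θ * X)) + X ^ 3 * Real.exp (-(θ * X)) * (b * s ^ 4)⁻¹ := by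
    rw [hX]; field_simp
  rw [e]
  have hlast : X ^ 3 * Real.exp (-(θ * X)) * (b * s ^ 4)⁻¹ ≤ (3 / θ) ^ 3 := by
    have hinv : (b * s ^ 4)⁻¹ ≤ 1 := inv_le_one_of_one_le₀ hreg
    have hnn : 0 ≤ X ^ 3 * Real.exp (-(θ * X)) := by positivity
    calc X ^ 3 * Real.exp (-(θ * X)) * (b * s ^ 4)⁻¹ ≤ X ^ 3 * Real.exp (-(θ * X)) * 1 := by gcongr
      _ ≤ (3 / θ) ^ 3 := by rw [mul_one]; exact h3
  linarith

/-- The Gaussian branch (`b′s⁴ ≤ 1`): `e^{−θb′s²q}·b′s²(s²+q) ≤ 1 + 1∕θ`. [folklore] -/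
theorem capHill_gaussian_core {θ b s q : ℝ} (hθ : 0 < θ) (hb : 0 < b) (hs : 0 < s) (hq : 0 < q) (hreg : b * s ^ 4 ≤ 1) :
    Real.exp (-(θ * (b * s ^ 2 * q))) * (b * s ^ 2 * (s ^ 2 + q)) ≤ 1 + 1 / θ := by
  set X := b * s ^ 2 * q with hX
  have hX0 : 0 ≤ X := by positivity
  have hE1 : Real.exp (-(θ * X)) ≤ 1 := Real.exp_le_one_iff.2 (by nlinarith [hθ.le, hX0])
  have hE0 : 0 ≤ Real.exp (-(θ * X)) := (Real.exp_pos _).le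
  have h1 := mul_exp_neg_le X hθ
  have e : Real.exp (-(θ * X)) * (b * s ^ 2 * (s ^ 2 + q)) = Real.exp (-(θ * X)) * (b * s ^ 4) + X * Real.exp (-(θ * X)) := by
    rw [hX]; ring
  rw [e]
  have hfirst : Real.exp (-(θ * X)) * (b * s ^ 4) ≤ 1 := by
    calc Real.exp (-(θ * X)) * (b * s ^ 4) ≤ 1 * 1 := by gcongr
      _ = 1 := one_mul 1
  linarith

/-- ★ §3 THE HILLTOP CAPS: for areas `A₁, A₂ ≥ 0` and `θ, C, b′, s, q > 0`,
`q²·(A₁·e^{−θb′s²q})·min(A₂, π∕(b′Cq²)) ≤ (A₁A₂((2∕θ)² + (3∕θ)³) + (A₁π∕C)(1 + 1∕θ))∕(b′²s²(s²+q))` — regime split `b′s⁴ ≷ 1`. [folklore] -/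
theorem capHill_profile_le {A₁ A₂ θ C b s q : ℝ} (hA₁ : 0 ≤ A₁) (hA₂ : 0 ≤ A₂) (hθ : 0 < θ) (hC : 0 < C) (hb : 0 < b) (hs : 0 < s)
    (hq : 0 < q) :
    q ^ 2 * (A₁ * Real.exp (-(θ * (b * s ^ 2 * q)))) * min A₂ (π / (b * C * q ^ 2)) ≤
      (A₁ * A₂ * ((2 / θ) ^ 2 + (3 / θ) ^ 3) + A₁ * π / C * (1 + 1 / θ)) / (b ^ 2 * s ^ 2 * (s ^ 2 + q)) := by
  have hD : 0 < b ^ 2 * s ^ 2 * (s ^ 2 + q) := by positivity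
  have hE0 : 0 ≤ Real.exp (-(θ * (b * s ^ 2 * q))) := (Real.exp_pos _).le
  have hK1 : 0 ≤ A₁ * A₂ * ((2 / θ) ^ 2 + (3 / θ) ^ 3) := by positivity
  have hK2 : 0 ≤ A₁ * π / C * (1 + 1 / θ) := by positivity
  rw [le_div_iff₀ hD]
  rcases le_or_gt 1 (b * s ^ 4) with hreg | hreg
  · -- saturated relative factor
    have hmin : min A₂ (π / (b * C * q ^ 2)) ≤ A₂ := min_le_left _ _
    have hmin0 : 0 ≤ min A₂ (π / (b * C * q ^ 2)) := le_min hA₂ (by positivity)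
    have hcore := capHill_saturated_core hθ hb hs hq hreg
    calc q ^ 2 * (A₁ * Real.exp (-(θ * (b * s ^ 2 * q)))) * min A₂ (π / (b * C * q ^ 2)) * (b ^ 2 * s ^ 2 * (s ^ 2 + q))
        ≤ q ^ 2 * (A₁ * Real.exp (-(θ * (b * s ^ 2 * q)))) * A₂ * (b ^ 2 * s ^ 2 * (s ^ 2 + q)) := by gcongr
      _ = A₁ * A₂ * (q ^ 2 * Real.exp (-(θ * (b * s ^ 2 * q))) * (b ^ 2 * s ^ 2 * (s ^ 2 + q))) := by ring
      _ ≤ A₁ * A₂ * ((2 / θ) ^ 2 + (3 / θ) ^ 3) := by gcongr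
      _ ≤ A₁ * A₂ * ((2 / θ) ^ 2 + (3 / θ) ^ 3) + A₁ * π / C * (1 + 1 / θ) := by linarith
  · -- Gaussian relative factor
    have hmin : min A₂ (π / (b * C * q ^ 2)) ≤ π / (b * C * q ^ 2) := min_le_right _ _
    have hmin0 : 0 ≤ min A₂ (π / (b * C * q ^ 2)) := le_min hA₂ (by positivity)
    have hcore := capHill_gaussian_core hθ hb hs hq hreg.le
    calc q ^ 2 * (A₁ * Real.exp (-(θ * (b * s ^ 2 * q)))) * min A₂ (π / (b * C * q ^ 2)) * (b ^ 2 * s ^ 2 * (s ^ 2 + q))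
        ≤ q ^ 2 * (A₁ * Real.exp (-(θ * (b * s ^ 2 * q)))) * (π / (b * C * q ^ 2)) * (b ^ 2 * s ^ 2 * (s ^ 2 + q)) := by gcongr
      _ = A₁ * π / C * (Real.exp (-(θ * (b * s ^ 2 * q))) * (b * s ^ 2 * (s ^ 2 + q))) := by field_simp
      _ ≤ A₁ * π / C * (1 + 1 / θ) := by gcongr
      _ ≤ A₁ * A₂ * ((2 / θ) ^ 2 + (3 / θ) ^ 3) + A₁ * π / C * (1 + 1 / θ) := by linarith

/-! ## §4 The Profile -/

/-- §4 `(s²(s² + h))⁻¹ = (1+δ²)²∕(1 + h(1+δ²))` for `s² = (1+δ²)⁻¹` — the frozen binder's Profile of (hCore). [folklore] -/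
theorem profile_eq (δ h : ℝ) :
    ((1 + δ ^ 2)⁻¹ * ((1 + δ ^ 2)⁻¹ + h))⁻¹ = (1 + δ ^ 2) ^ 2 / (1 + h * (1 + δ ^ 2)) := by
  have hD : 0 < 1 + δ ^ 2 := by positivity
  rw [← one_div]
  field_simp

/-- §4 the same with `s = √((1+δ²)⁻¹)` squared back: `s² = (1+δ²)⁻¹` for `s := (√(1+δ²))⁻¹`. [folklore] -/
theorem inv_sqrt_one_add_sq_sq (δ : ℝ) : ((Real.sqrt (1 + δ ^ 2))⁻¹) ^ 2 = (1 + δ ^ 2)⁻¹ := by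
  rw [inv_pow, Real.sq_sqrt (by positivity)]

/-- §4 monotonicity: the Profile currency is antitone in the base size, `q ≤ q′ ⟹ (s²(s²+q′))⁻¹ ≤ (s²(s²+q))⁻¹`. [folklore] -/
theorem profile_antitone {s q q' : ℝ} (hs : 0 < s) (hq : 0 ≤ q) (hqq : q ≤ q') :
    (s ^ 2 * (s ^ 2 + q'))⁻¹ ≤ (s ^ 2 * (s ^ 2 + q))⁻¹ := by
  apply inv_anti₀ (by positivity)
  gcongr

end Summit.QuantumFields.YangMills.Theorems.QuantitativeLaplace

end
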